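import Summits.BirchSwinnertonDyer.BirchSwinnertonDyer.Theorems.CumulativeHeegnerLeopoldtCumulativeHeegnerInclusionAtThreeResidualDevissage
import Summits.BirchSwinnertonDyer.BirchSwinnertonDyer.Theorems.UniversalToricDescentAcDualMuZeroCriterion
import Summits.BirchSwinnertonDyer.Rank1Residual.X11b.RouteR1IntReceptacle
import Summits.BirchSwinnertonDyer.BirchSwinnertonDyer.Theorems.SchneiderFreeAdditiveX3Defs
import Literature.NumberTheory.EllipticCurves.Rank1Residual.Predicates
import Literature.NumberTheory.EllipticCurves.HeegnerPoints
import Literature.NumberTheory.EllipticCurves.ModularCurve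
import Literature.NumberTheory.EllipticCurves.IwasawaCharGeneratorMuLambda
import Literature.RingTheory.PowerSeries.ResidualOrderAssociated
import HarnessLib

/-!
# Route `PrintCFram`, crux C2 `BottomClassIndexLawFiveLe` (stmt-BirchSwinnertonDyer-20372), line `eisenstein-resource-bdp-line`:
# the ALGEBRAIC half of the invariant-match stub — `X_(∅,0)` is finitely generated (free), TORSION with `μ = 0` from the residual
# line devissage (the tree's CGLS-§3 skeleton, reduction-type-free), and then the registered «invariant match» reduces to ONE
# analytic inequality «the first `λ(X)` coefficients of `Q` are non-units»
# (cell `bsd-print-cfram`, seat `bsd-line-cfram-p1` LEAD g3; helper `--supports` 20372; THEOREMS ONLY, 0 facts)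

HONEST FRAMING. Nothing about BSD is proved; the stub `stub_invariantMatch_cmRamified` is NOT closed. GENERIC statements (any
elliptic curve over a number field `K`, any `ℤ_p`-extension `κ`, any frame), assembled from LANDED theorems of other cells:
the residual line devissage `CumulativeHeegnerInclusionAtThreeResidualDevissage.finite_selmerAc_empty_pTorsion_of_line_devissage`
(route CumulativeHeegnerLeopoldt, p-generic despite the file name), Greenberg's criterion (A) on Castella's dual
`UniversalToricDescentAcDualMuZero.isTorsion_of_finite_pTorsion` / `muInvariant_eq_zero_of_finite_pTorsion` / `XAc.module_finite`
(route UniversalToricDescent), and the LEAD g3 Literature files (char generator `p^μ·g₀` with `ord ḡ₀ = λ`; residual order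
transport along `ℤ_p → 𝓞_{ℂ_p}`).

* `moduleFinite_XAc_empty` — `X = X_ac^∅` is a finitely generated `Λ`-module (no hypothesis: `Σ = ∅` is finite).
* `isTorsion_and_mu_eq_zero_of_line_devissage` — given a `Γ_K`-stable line `Φ ≤ E[p]` with `(E[p]/Φ)^{G_{K_{∞,𝔭}}} = 0`, a set `S`
  containing the bad places prime to `p`, `D_𝔭 ⊄ ker κ`, and FINITE residual Selmer groups of the two character pieces `Φ`, `E[p]/Φ`
  (CGLS Prop. 14-type inputs): `X_ac^∅(E[p^∞])` (strict at `𝔭`) is `Λ`-torsion with `μ = 0`.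
* `invariantMatch_of_mu_eq_zero_of_coeff_mem` — for ANY frame: if `X` is f.g. torsion with `μ(X) = 0` and the first `λ(X)`
  coefficients of `Q ∈ 𝓞_{ℂ_p}⟦T⟧` have norm `< 1`, then the «invariant match» holds at `n = λ(X)`: some element of the mapped
  characteristic ideal (namely the image of the char generator `g₀`) has a UNIT `λ(X)`-th coefficient.
So on the CM-ramified rows the registered stub 2′ = {line-devissage inputs (the rational `p`-isogeny line `W[𝔭]`, characters
`χ_d ω^{(p+1)/4}`, `χ_d ω^{(3p−1)/4}` — w2's kernel theorems; CGLS Prop. 14 for them over the `p`-split `K''`)} ∧ {the ANALYTIC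
inequality `ord Q̄ ≥ λ(X)` (Λ-adic congruence + GL₁ main conjecture over `K''`)}. BSD is not proved by any of this.

References: Castella–Grossi–Lee–Skinner, Invent. Math. 227 (2022) §3 (Props. 14, 17, 18; Thm. 3.2.1) [CastellaGrossiLeeSkinner2022];
Greenberg LNM 1716 §1, Prop. 5.10 [GreenbergLNM1716]; Greenberg–Vatsal 2000 Prop. (2.8) [GreenbergVatsal2000]; Washington GTM 83
§13.2 [Washington1997].
-/

noncomputable section

open scoped Classical

set_option linter.dupNamespace false
set_option autoImplicit false

namespace Summit.BirchSwinnertonDyer.BirchSwinnertonDyer.Theorems.PrintCFram.EisensteinResourceBdpLine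

open WeierstrassCurve NumberField IsDedekindDomain Field PowerSeries
  Literature.NumberTheory.EllipticCurves Literature.NumberTheory.EllipticCurves.GreenbergSelmer
  Literature.NumberTheory.EllipticCurves.ModularForms Literature.NumberTheory.EllipticCurves.Rank1Residual
  Summit.BirchSwinnertonDyer.BirchSwinnertonDyer.Theorems.SchneiderFree
  Literature.NumberTheory.EllipticCurves.GreenbergVatsal2000
  Literature.NumberTheory.EllipticCurves.IwasawaAlgebra
  Literature.NumberTheory.GaloisRepresentations
  Summit.BirchSwinnertonDyer.Rank1Residual Summit.BirchSwinnertonDyer.Rank1Residual.X11b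
  Summit.BirchSwinnertonDyer.Rank1Residual.X11b.AcSelmer
  Summit.BirchSwinnertonDyer.Rank1Residual.X2.ResidualDevissageModules
  Summit.BirchSwinnertonDyer.BirchSwinnertonDyer.Theorems.CumulativeHeegnerInclusionAtThreeResidualDevissage
  Summit.BirchSwinnertonDyer.BirchSwinnertonDyer.Theorems.UniversalToricDescentAcDualMuZero

universe u

variable {K : Type} [Field K] [NumberField K]

/-! ## §1 `X_ac^∅` is finitely generated, and torsion with `μ = 0` from the residual line devissage -/

section Algebraic

variable (W : WeierstrassCurve K) [W.IsElliptic] {p : ℕ} [Fact p.Prime] (κ : ZpExtension K p)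
  (𝔭 : HeightOneSpectrum (𝓞 K)) (γ : absoluteGaloisGroup K) [Fact (κ.IsTopGenerator γ)]

/-- **`X_ac^∅(E[p^∞])` (strict at `𝔭`) is a finitely generated `Λ`-module** — the tree's `XAc.module_finite` at the finite set
`Σ = ∅`; no hypothesis. (The `Module.Finite` conjunct of the LEAD's `hinvM` is free.) [cite: GreenbergLNM1716, §1 p. 60] -/
theorem moduleFinite_XAc_empty : Module.Finite (IwasawaAlgebra p) (XAc W p κ 𝔭 ∅ γ) :=
  XAc.module_finite κ 𝔭 ∅ γ Set.finite_empty (W := W)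

/-- **Torsion with `μ = 0` from the residual line devissage** (CGLS §3 skeleton, reduction-type-free): for a `Γ_K`-stable line
`Φ ≤ E[p]` whose quotient has no non-zero `G_{K_{∞,𝔭}}`-fixed vector, `D_𝔭 ⊄ ker κ`, a set `S ⊇` the bad places prime to `p`, and
FINITE residual Selmer groups of `Φ` and `E[p]/Φ` (strict at `𝔭`, unramified outside `S`): Castella's dual `X_ac^∅(E[p^∞])` (strict at
`𝔭`, no auxiliary places) is a torsion `Λ`-module with `μ`-invariant `0`. Composition of
`finite_selmerAc_empty_pTorsion_of_line_devissage` with Greenberg's criterion (A) (`isTorsion_of_finite_pTorsion`,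
`muInvariant_eq_zero_of_finite_pTorsion`). CONDITIONAL on the displayed residual finiteness (CGLS Prop. 14-type inputs); nothing
about any `L`-function. [cite: CastellaGrossiLeeSkinner2022, §3 (arXiv:2008.02571 §1, Props. 14, 17, 18)]
[cite: GreenbergVatsal2000, §2 Prop. (2.8)] -/
theorem isTorsion_and_mu_eq_zero_of_line_devissage (h𝔭 : ((p : ℕ) : 𝓞 K) ∈ 𝔭.asIdeal)
    (h𝔭dec : ¬ (decomp 𝔭 ≤ κ.kerSubgroup)) {S : Set (HeightOneSpectrum (𝓞 K))}
    (hS : ∀ v : HeightOneSpectrum (𝓞 K), v ∉ S → ((p : ℕ) : 𝓞 K) ∉ v.asIdeal → W.HasGoodReductionAt v)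
    (Φ : StableSubgroup (absoluteGaloisGroup K) (W.geomTorsion (p : ℤ)))
    (hfix : ∀ y : Φ.Quot, (∀ g : ↥(κ.kerSubgroup ⊓ decomp 𝔭), g • y = y) → y = 0)
    (hΦ : (datumStrictSelmer κ.kerSubgroup Φ.Sub p (AcSelmer.bdpData Φ.Sub p 𝔭) S :
      Set (subgroupH1 κ.kerSubgroup Φ.Sub)).Finite)
    (hΨ : (datumStrictSelmer κ.kerSubgroup Φ.Quot p (AcSelmer.bdpData Φ.Quot p 𝔭) S :
      Set (subgroupH1 κ.kerSubgroup Φ.Quot)).Finite) :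
    Module.IsTorsion (IwasawaAlgebra p) (XAc W p κ 𝔭 ∅ γ) ∧ muInvariant p (XAc W p κ 𝔭 ∅ γ) = 0 := by
  have hfin := finite_selmerAc_empty_pTorsion_of_line_devissage W κ h𝔭 h𝔭dec hS Φ hfix hΦ hΨ
  exact ⟨isTorsion_of_finite_pTorsion W p κ 𝔭 ∅ γ Set.finite_empty hfin,
    muInvariant_eq_zero_of_finite_pTorsion W p κ 𝔭 ∅ γ Set.finite_empty hfin⟩

end Algebraic

/-! ## §2 Given `μ(X) = 0`: the «invariant match» from ONE analytic inequality -/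

section Match

variable {p : ℕ} [Fact p.Prime]

/-- Norm of the image of a `p`-adic integer under the structure map `ℤ_p → 𝓞_{ℂ_p}`. [folklore] -/
private theorem norm_toCpInt (a : ℤ_[p]) : ‖((R1.toCpInt p a : PadicComplexInt p) : ℂ_[p])‖ = ‖a‖ := by
  rw [R1.coe_toCpInt, norm_algebraMap', PadicInt.padic_norm_e_of_padicInt]

/-- **The «invariant match» from `μ(X) = 0` and the analytic inequality `ord Q̄ ≥ λ(X)`.** Let `X` be a finitely generated torsion
`Λ`-module with `μ(X) = 0`, `I` its characteristic ideal and `Q ∈ 𝓞_{ℂ_p}⟦T⟧` whose first `λ(X)` coefficients have norm `< 1`.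
Then at `n = λ(X)`: the first `n` coefficients of `Q` have norm `< 1` (given) and the image of the char generator `g₀`
(`char(X) = (p^0·g₀)`, `ord ḡ₀ = λ(X)`: `exists_charIdeal_eq_span_C_pow_mu_mul`) is an element of the mapped ideal with a UNIT
`n`-th coefficient (a `p`-adic integer outside `(p)` has norm `1`, preserved by `ℤ_p → 𝓞_{ℂ_p}`). This is the exact conclusion
shape of the registered `stub_invariantMatch_cmRamified` at one frame. [cite: CastellaGrossiLeeSkinner2022, Thm. 3.2.1 and proof of Thm. 5.1.1 (arXiv:2008.02571 pp. 4, 23)]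
[cite: Washington1997, §13.2] -/
theorem invariantMatch_of_mu_eq_zero_of_coeff_norm_lt (X : Type*) [AddCommGroup X] [Module (IwasawaAlgebra p) X]
    [Module.Finite (IwasawaAlgebra p) X] (hX : Module.IsTorsion (IwasawaAlgebra p) X) (hμ : muInvariant p X = 0)
    (Q : PowerSeries (PadicComplexInt p))
    (hQ : ∀ m < lambdaInvariant p X, ‖((PowerSeries.coeff m Q : PadicComplexInt p) : ℂ_[p])‖ < 1) :
    ∃ n : ℕ, (∀ m < n, ‖((PowerSeries.coeff m Q : PadicComplexInt p) : ℂ_[p])‖ < 1) ∧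
      ∃ G ∈ (Module.charIdeal (IwasawaAlgebra p) X).map (PowerSeries.map (R1.toCpInt p)),
        ‖((PowerSeries.coeff n G : PadicComplexInt p) : ℂ_[p])‖ = 1 := by
  obtain ⟨g₀, hchar, hg₀, hord⟩ := exists_charIdeal_eq_span_C_pow_mu_mul (p := p) X hX
  refine ⟨lambdaInvariant p X, hQ, PowerSeries.map (R1.toCpInt p) g₀, ?_, ?_⟩
  · rw [hchar, hμ, pow_zero, map_one, one_mul, Ideal.map_span, Set.image_singleton]
    exact Ideal.mem_span_singleton_self _
  · -- the `λ(X)`-th coefficient of `g₀` is a `p`-adic unit: it is the first coefficient not in `(p)`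
    have hne : PowerSeries.coeff (lambdaInvariant p X) (PowerSeries.map (IsLocalRing.residue ℤ_[p]) g₀) ≠ 0 := by
      have h := PowerSeries.coeff_order (φ := PowerSeries.map (IsLocalRing.residue ℤ_[p]) g₀) hg₀
      rwa [hord, ENat.toNat_coe] at h
    rw [PowerSeries.coeff_map, Ne, IsLocalRing.residue_eq_zero_iff] at hne
    have hunit : IsUnit (PowerSeries.coeff (lambdaInvariant p X) g₀) := by
      by_contra h; exact hne ((IsLocalRing.mem_maximalIdeal _).mpr h)
    rw [PowerSeries.coeff_map, norm_toCpInt, PadicInt.isUnit_iff.mp hunit]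

end Match


/-! ## §3 The REGISTERED stub 2′ from the two halves: residual line devissage (algebraic) + one analytic inequality -/

section Assembly

/-- **Registered `stub_invariantMatch_cmRamified` (signature verbatim) ⟸ (ALG) residual line-devissage data at every frame ∧ (AN)
the analytic inequality «the first `λ(X_(∅,0))` coefficients of `Q` are non-units».** (ALG) = at each frame: Brink's
`D_{𝔭'} ⊄ ker κ` (a tree fact for anticyclotomic `κ`), a `Γ_{K''}`-stable line `Φ ≤ W[p]` over `K''` with
`(W[p]/Φ)^{G_{K''_{∞,𝔭'}}} = 0`, a set `S ⊇` the bad places prime to `p`, and FINITE residual Selmer groups of `Φ`, `W[p]/Φ` (CGLS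
Prop. 14 for the characters `χ_d ω^{(p+1)/4}`, `χ_d ω^{(3p−1)/4}` over the `p`-split `K''`); (AN) = `λ_an(Q) ≥ λ_alg(X)` with
`μ_an(Q)`-free phrasing. Proof: §1 (torsion, `μ = 0`, f.g.) then §2. CONDITIONAL on (ALG) and (AN); closes nothing; BSD is not proved.
[cite: CastellaGrossiLeeSkinner2022, §3 Props. 14, 17, 18 and Thm. 3.2.1 (arXiv:2008.02571 §1, p. 4)] [cite: GreenbergVatsal2000, §2 Prop. (2.8)] -/
theorem stub_invariantMatch_cmRamified_of_lineDevissage_of_analyticInequality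
    (hdev : ∀ (p : ℕ) [Fact p.Prime] (W : WeierstrassCurve ℚ) [W.IsElliptic] [W.IsGloballyMinimal],
      W.HasCM → CMRamified W p → 5 ≤ p → W.analyticRank = 1 →
      ∀ (N : ℕ) [NeZero N] (K : Type) [Field K] [NumberField K] (Dt : ModularParametrizationData W N),
      W.conductorNorm ℤ = N → IsImaginaryQuadratic K → SatisfiesHeegnerHypothesis N K →
      ∀ (κ : ZpExtension K p), κ.IsAnticyclotomic → ∀ (γ : Field.absoluteGaloisGroup K) [Fact (κ.IsTopGenerator γ)]
        (𝔭 : HeightOneSpectrum (𝓞 K)), ((p : ℕ) : 𝓞 K) ∈ 𝔭.asIdeal → 𝔭.asIdeal.ramificationIdx (𝓞 ℚ) = 1 →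
        𝔭.asIdeal.inertiaDeg (𝓞 ℚ) = 1 → ∀ (𝔭' : HeightOneSpectrum (𝓞 K)), ((p : ℕ) : 𝓞 K) ∈ 𝔭'.asIdeal → 𝔭' ≠ 𝔭 →
        ∀ (ι' : PadicAlgCl p ≃+* ℂ), SchneiderFree.BranchInducesPrime p ι' 𝔭 →
        ∀ (ΩK : ℂ) (Ωp : ℂ_[p]) (Q : PowerSeries (PadicComplexInt p)), ΩK ≠ 0 → Ωp ≠ 0 →
          R1.IsBDPLFunctionInt p ι' 𝔭 κ γ Dt.f ΩK Ωp Q →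
          ¬ (decomp 𝔭' ≤ κ.kerSubgroup) ∧
          ∃ (S : Set (HeightOneSpectrum (𝓞 K)))
            (Φ : StableSubgroup (absoluteGaloisGroup K) ((W.baseChange K).geomTorsion (p : ℤ))),
            (∀ v : HeightOneSpectrum (𝓞 K), v ∉ S → ((p : ℕ) : 𝓞 K) ∉ v.asIdeal →
              (W.baseChange K).HasGoodReductionAt v) ∧
            (∀ y : Φ.Quot, (∀ g : ↥(κ.kerSubgroup ⊓ decomp 𝔭'), g • y = y) → y = 0) ∧
            (datumStrictSelmer κ.kerSubgroup Φ.Sub p (AcSelmer.bdpData Φ.Sub p 𝔭') S :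
              Set (subgroupH1 κ.kerSubgroup Φ.Sub)).Finite ∧
            (datumStrictSelmer κ.kerSubgroup Φ.Quot p (AcSelmer.bdpData Φ.Quot p 𝔭') S :
              Set (subgroupH1 κ.kerSubgroup Φ.Quot)).Finite)
    (han : ∀ (p : ℕ) [Fact p.Prime] (W : WeierstrassCurve ℚ) [W.IsElliptic] [W.IsGloballyMinimal],
      W.HasCM → CMRamified W p → 5 ≤ p → W.analyticRank = 1 →
      ∀ (N : ℕ) [NeZero N] (K : Type) [Field K] [NumberField K] (Dt : ModularParametrizationData W N),
      W.conductorNorm ℤ = N → IsImaginaryQuadratic K → SatisfiesHeegnerHypothesis N K →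
      ∀ (κ : ZpExtension K p), κ.IsAnticyclotomic → ∀ (γ : Field.absoluteGaloisGroup K) [Fact (κ.IsTopGenerator γ)]
        (𝔭 : HeightOneSpectrum (𝓞 K)), ((p : ℕ) : 𝓞 K) ∈ 𝔭.asIdeal → 𝔭.asIdeal.ramificationIdx (𝓞 ℚ) = 1 →
        𝔭.asIdeal.inertiaDeg (𝓞 ℚ) = 1 → ∀ (𝔭' : HeightOneSpectrum (𝓞 K)), ((p : ℕ) : 𝓞 K) ∈ 𝔭'.asIdeal → 𝔭' ≠ 𝔭 →
        ∀ (ι' : PadicAlgCl p ≃+* ℂ), SchneiderFree.BranchInducesPrime p ι' 𝔭 →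
        ∀ (ΩK : ℂ) (Ωp : ℂ_[p]) (Q : PowerSeries (PadicComplexInt p)), ΩK ≠ 0 → Ωp ≠ 0 →
          R1.IsBDPLFunctionInt p ι' 𝔭 κ γ Dt.f ΩK Ωp Q →
          ∀ m < lambdaInvariant p (XAc (W.baseChange K) p κ 𝔭' ∅ γ),
            ‖((PowerSeries.coeff m Q : PadicComplexInt p) : ℂ_[p])‖ < 1) :
    ∀ (p : ℕ) [Fact p.Prime] (W : WeierstrassCurve ℚ) [W.IsElliptic] [W.IsGloballyMinimal],
      W.HasCM → CMRamified W p → 5 ≤ p → W.analyticRank = 1 →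
      ∀ (N : ℕ) [NeZero N] (K : Type) [Field K] [NumberField K] (Dt : ModularParametrizationData W N),
      W.conductorNorm ℤ = N → IsImaginaryQuadratic K → SatisfiesHeegnerHypothesis N K →
      ∀ (κ : ZpExtension K p), κ.IsAnticyclotomic → ∀ (γ : Field.absoluteGaloisGroup K) [Fact (κ.IsTopGenerator γ)]
        (𝔭 : HeightOneSpectrum (𝓞 K)), ((p : ℕ) : 𝓞 K) ∈ 𝔭.asIdeal → 𝔭.asIdeal.ramificationIdx (𝓞 ℚ) = 1 →
        𝔭.asIdeal.inertiaDeg (𝓞 ℚ) = 1 → ∀ (𝔭' : HeightOneSpectrum (𝓞 K)), ((p : ℕ) : 𝓞 K) ∈ 𝔭'.asIdeal → 𝔭' ≠ 𝔭 →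
        ∀ (ι' : PadicAlgCl p ≃+* ℂ), SchneiderFree.BranchInducesPrime p ι' 𝔭 →
        ∀ (ΩK : ℂ) (Ωp : ℂ_[p]) (Q : PowerSeries (PadicComplexInt p)), ΩK ≠ 0 → Ωp ≠ 0 →
          R1.IsBDPLFunctionInt p ι' 𝔭 κ γ Dt.f ΩK Ωp Q →
          ∃ n : ℕ, (∀ m < n, ‖((PowerSeries.coeff m Q : 𝓞_ℂ_[p]) : ℂ_[p])‖ < 1) ∧
            ∃ G ∈ (XAc.charIdeal (W.baseChange K) p κ 𝔭' ∅ γ).map (PowerSeries.map (R1.toCpInt p)),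
              ‖((PowerSeries.coeff n G : 𝓞_ℂ_[p]) : ℂ_[p])‖ = 1 := by
  intro p _ W _ _ hCM hram h5 hr N _ K _ _ Dt hN hK hHN κ hκ γ _ 𝔭 h𝔭 he hf 𝔭' h𝔭' hne ι' hind ΩK Ωp Q hΩK hΩp hBDP
  obtain ⟨hdec, S, Φ, hS, hfix, hΦ, hΨ⟩ :=
    hdev p W hCM hram h5 hr N K Dt hN hK hHN κ hκ γ 𝔭 h𝔭 he hf 𝔭' h𝔭' hne ι' hind ΩK Ωp Q hΩK hΩp hBDP
  have hQ := han p W hCM hram h5 hr N K Dt hN hK hHN κ hκ γ 𝔭 h𝔭 he hf 𝔭' h𝔭' hne ι' hind ΩK Ωp Q hΩK hΩp hBDP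
  haveI : (W.baseChange K).IsElliptic := by rw [WeierstrassCurve.baseChange]; infer_instance
  haveI := moduleFinite_XAc_empty (W.baseChange K) κ 𝔭' γ (p := p)
  obtain ⟨htors, hμ⟩ :=
    isTorsion_and_mu_eq_zero_of_line_devissage (W.baseChange K) κ 𝔭' γ h𝔭' hdec hS Φ hfix hΦ hΨ
  exact invariantMatch_of_mu_eq_zero_of_coeff_norm_lt (XAc (W.baseChange K) p κ 𝔭' ∅ γ) htors hμ Q hQ

end Assembly

end Summit.BirchSwinnertonDyer.BirchSwinnertonDyer.Theorems.PrintCFram.EisensteinResourceBdpLine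

end
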